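import Mathlib
import HarnessLib
import Summits.HubbardSuperconductivity.HubbardSuperconductivity.Theorems.KLProgrammeSWaveCascade

/-!
# Route `KLProgramme` — the s-wave-dressed Cooper cascade with SCALE-DEPENDENT shell weights is stable for a repulsive
# s-wave coupling ((E2-v2) `PairLadderStepAt` at every step ⇒ (B1-v2) `PairArrayAt`; row 0′ of the K3 supplier map)

Cell gate-hubbard-kl, seat p3; companion of `KLProgrammeSWaveCascade.lean` (fixed weights, four-block contraction).  In p1's
(E2-v2) (`PairLadderStepAt`, `KLProgrammeKLRegimeSplitPredicatesV2.lean`) the one-scale ladder at step `n` carries its OWN weights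
`w_n ≥ 0` on the carrier (the single-scale bubble, supported on shell `n`; mass `W_n = Σ w_n ≤ bhi`), so the weighted averages change
from step to step and the fixed-weight block decomposition does not iterate.  The remedy is a WEIGHT-INDEPENDENT decomposition of
the non-s-wave part: `𝒟_n = K_n + (row-constant) + (column-constant) + σ_n·J`, driven by the implicit step

  `𝒟' + U·(𝒟' ∗_w J) = 𝒟 - U'·(J ∗_w 𝒟) + E`,   `E = T - 𝒟' ∗_w 𝒟`,   `U' (1 + W U) = U`   (`step_decompose'`, division-free),

in which `J ∗_w X` is constant along columns' index `s` (a ROW-type array: the `w`-weighted column sums) and `X ∗_w J` is constant in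
`t` (COLUMN-type).  The core `K` accumulates the tails raw (`K' = K + E`); the row part obeys `R' = (1 - U'W) R - U'·colSum_w K`, the
column part `C' (1 + UW) = C - U·rowSum_w K'`, the scalar `σ'(1+UW) = σ(1-U'W) - U'⟨C⟩_w - U⟨R'⟩_w` — CONVEX-type recursions whose
coefficients are in `[0,1]` BECAUSE `U ≥ 0` (`U'W ≤ 1` automatically), so `sup|R_n|, sup|C_n|, |σ_n| ≤ k_n := esup 𝒟_0 + Σ_{j<n} esup E_j`
(`decomp_bounds`) and `esup 𝒟_n ≤ 4 k_n`; then `implicit_gronwall` (the quadratic tail `W_n·esup 𝒟_{n+1}·esup 𝒟_n`) gives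
**`sWaveCascade_envelope_varying`**: `esup (𝒞_n - U_n J) ≤ 8·(esup (𝒞_0 - U_0 J) + Σ_{j<N} esup T_j)` for all `n ≤ N`, `0 ≤ U_n ≤ U_0`,
under the smallness `8·16·(esup 𝒟_0 + Σ esup T)·Σ_n W_n ≤ 1` — uniformly, no loss in `1/U`, no assumption relating the weights of
different steps.  Everything is proved; no definitions (row/column-type arrays are written as lambdas).
References: HOME/STATUS 2026-08-26 p1 g5 10:44:42Z (`PairLadderStepAt`/`PairArrayAt` shapes), plan g9 10:22:35Z (row 0′ = p3).
-/

noncomputable section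

namespace Summit.HubbardSuperconductivity.HubbardSuperconductivity.Theorems.SWaveCascade

set_option linter.dupNamespace false -- summit = problem name (single-conjunct summit), D-0017

open Finset

variable {S : Type*} [Fintype S]

/-! ## §5a Division-free s-wave identities and the step decomposition -/

/-- `J ∗_w A` is the row-type array of the `w`-weighted column sums. -/
theorem wmul_onesArr_left_eq (w : S → ℝ) (A : S → S → ℂ) :
    wmul w onesArr A = fun _ t => ∑ u, (w u : ℂ) * A u t := by
  funext s t; simp [wmul, onesArr]

/-- `A ∗_w J` is the column-type array of the `w`-weighted row sums. -/
theorem wmul_onesArr_right_eq (w : S → ℝ) (A : S → S → ℂ) :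
    wmul w A onesArr = fun s _ => ∑ u, A s u * (w u : ℂ) := by
  funext s t; simp [wmul, onesArr]

/-- **Division-free step decomposition.**  If `𝒞' = 𝒞 - 𝒞' ∗_w 𝒞 + T` and `U' (1 + W U) = U` (`W = Σ w`), then with
`𝒟 = 𝒞 - U J`, `𝒟' = 𝒞' - U' J`:  `𝒟' + U·(𝒟' ∗_w J) = 𝒟 - U'·(J ∗_w 𝒟) + (T - 𝒟' ∗_w 𝒟)`. -/
theorem step_decompose' (w : S → ℝ) {𝒞 𝒞' T 𝒟 𝒟' : S → S → ℂ} {U U' : ℝ}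
    (hstep : 𝒞' = 𝒞 - wmul w 𝒞' 𝒞 + T) (hU : U' * (1 + (∑ u, w u) * U) = U)
    (h𝒟 : 𝒟 = 𝒞 - (U : ℂ) • onesArr) (h𝒟' : 𝒟' = 𝒞' - (U' : ℂ) • onesArr) :
    𝒟' + (U : ℂ) • wmul w 𝒟' onesArr = 𝒟 - (U' : ℂ) • wmul w onesArr 𝒟 + (T - wmul w 𝒟' 𝒟) := by
  have h𝒞 : 𝒞 = (U : ℂ) • onesArr + 𝒟 := by rw [h𝒟]; abel
  have h𝒞' : 𝒞' = (U' : ℂ) • onesArr + 𝒟' := by rw [h𝒟']; abel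
  have hprod : wmul w 𝒞' 𝒞 = ((U' : ℂ) * (U : ℂ) * (((∑ u, w u : ℝ)) : ℂ)) • onesArr +
      (U' : ℂ) • wmul w onesArr 𝒟 + (U : ℂ) • wmul w 𝒟' onesArr + wmul w 𝒟' 𝒟 := by
    rw [h𝒞, h𝒞', wmul_add_left, wmul_add_right, wmul_add_right, wmul_smul_left, wmul_smul_left, wmul_smul_right,
      wmul_smul_right, wmul_onesArr_onesArr]
    simp only [smul_smul]
    have e1 : (U' : ℂ) * ((U : ℂ) * (((∑ u, w u : ℝ)) : ℂ)) = (U' : ℂ) * (U : ℂ) * (((∑ u, w u : ℝ)) : ℂ) := by ring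
    rw [e1]
    abel
  funext s t
  have hpt := congrFun (congrFun hstep s) t
  have hpr := congrFun (congrFun hprod s) t
  have e𝒟 : 𝒟 s t = 𝒞 s t - (U : ℂ) := by rw [h𝒟]; simp [onesArr]
  have e𝒟' : 𝒟' s t = 𝒞' s t - (U' : ℂ) := by rw [h𝒟']; simp [onesArr]
  simp only [Pi.add_apply, Pi.sub_apply, Pi.smul_apply, smul_eq_mul, onesArr, mul_one] at hpt hpr ⊢
  rw [hpr] at hpt
  have hUc : (U' : ℂ) * (1 + (((∑ u, w u : ℝ)) : ℂ) * (U : ℂ)) = (U : ℂ) := by exact_mod_cast hU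
  push_cast at hpt hUc ⊢
  linear_combination hpt - hUc + e𝒟' - e𝒟

/-- Uniqueness for the implicit step: `Z + U·(Z ∗_w J) = 0` with `U ≥ 0`, `w ≥ 0` forces `Z = 0`. -/
theorem eq_zero_of_add_smul_wmul_onesArr {w : S → ℝ} (hw : ∀ u, 0 ≤ w u) {U : ℝ} (hU : 0 ≤ U) {Z : S → S → ℂ}
    (h : Z + (U : ℂ) • wmul w Z onesArr = 0) : Z = 0 := by
  -- row sums: `(1 + U W) · rowSum Z = 0`
  have hW : 0 ≤ ∑ u, w u := sum_nonneg fun u _ => hw u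
  have hrow : ∀ s, ∑ u, Z s u * (w u : ℂ) = 0 := by
    intro s
    have hs : ∀ t, Z s t + (U : ℂ) * ∑ u, Z s u * (w u : ℂ) = 0 := fun t => by
      have := congrFun (congrFun h s) t
      simpa [wmul, onesArr] using this
    -- `A = Σ_t Z s t w_t` satisfies `A = -U A W`
    set A : ℂ := ∑ u, Z s u * (w u : ℂ) with hA_def
    have hZ : ∀ t, Z s t = -((U : ℂ) * A) := fun t => eq_neg_of_add_eq_zero_left (hs t)
    have hA : A = -((U : ℂ) * A) * ∑ t, (w t : ℂ) := by
      calc A = ∑ t, Z s t * (w t : ℂ) := rfl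
        _ = ∑ t, -((U : ℂ) * A) * (w t : ℂ) := sum_congr rfl fun t _ => by rw [hZ t]
        _ = -((U : ℂ) * A) * ∑ t, (w t : ℂ) := (mul_sum _ _ _).symm
    have hsum : A * (1 + (U : ℂ) * ∑ t, (w t : ℂ)) = 0 := by linear_combination hA
    have hne : (1 + (U : ℂ) * ∑ t, (w t : ℂ)) ≠ 0 := by
      have : (1 + (U : ℂ) * ∑ t, (w t : ℂ)) = (((1 + U * ∑ t, w t : ℝ)) : ℂ) := by push_cast; ring
      rw [this]; exact_mod_cast (by nlinarith : (0 : ℝ) < 1 + U * ∑ t, w t).ne'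
    exact (mul_eq_zero.1 hsum).resolve_right hne
  funext s t
  have := congrFun (congrFun h s) t
  simp only [Pi.add_apply, Pi.smul_apply, smul_eq_mul, Pi.zero_apply, wmul, onesArr, mul_one] at this
  rw [hrow s, mul_zero, add_zero] at this
  exact this


/-! ## §5b Row/column/scalar bookkeeping -/

/-- `(K + row R + col C + σJ) ∗_w J`, entrywise. -/
theorem wmul_decomp_onesArr (w : S → ℝ) (K : S → S → ℂ) (R C : S → ℂ) (σ : ℂ) (s t : S) :
    wmul w (K + (fun _ t' => R t') + (fun s' _ => C s') + σ • onesArr) onesArr s t =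
      (∑ u, K s u * (w u : ℂ)) + (∑ u, R u * (w u : ℂ)) + C s * (∑ u, (w u : ℂ)) + σ * (∑ u, (w u : ℂ)) := by
  simp only [wmul, onesArr, Pi.add_apply, Pi.smul_apply, smul_eq_mul, mul_one, add_mul, sum_add_distrib, mul_sum]

/-- `J ∗_w (K + row R + col C + σJ)`, entrywise. -/
theorem onesArr_wmul_decomp (w : S → ℝ) (K : S → S → ℂ) (R C : S → ℂ) (σ : ℂ) (s t : S) :
    wmul w onesArr (K + (fun _ t' => R t') + (fun s' _ => C s') + σ • onesArr) s t =
      (∑ u, (w u : ℂ) * K u t) + (∑ u, (w u : ℂ)) * R t + (∑ u, (w u : ℂ) * C u) + σ * (∑ u, (w u : ℂ)) := by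
  simp only [wmul, onesArr, Pi.add_apply, Pi.smul_apply, smul_eq_mul, mul_one, one_mul, mul_add, sum_add_distrib,
    sum_mul, mul_sum]
  congr 1
  exact sum_congr rfl fun u _ => by ring

/-- A weighted sum of entries bounded by `r` is bounded by `W·r` (`w ≥ 0`). -/
theorem norm_sum_mul_le {w : S → ℝ} (hw : ∀ u, 0 ≤ w u) {f : S → ℂ} {r : ℝ} (hf : ∀ u, ‖f u‖ ≤ r) :
    ‖∑ u, f u * (w u : ℂ)‖ ≤ (∑ u, w u) * r := by
  calc ‖∑ u, f u * (w u : ℂ)‖ ≤ ∑ u, ‖f u * (w u : ℂ)‖ := norm_sum_le _ _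
    _ ≤ ∑ u, w u * r := sum_le_sum fun u _ => by
        rw [norm_mul, Complex.norm_real, Real.norm_eq_abs, abs_of_nonneg (hw u), mul_comm]
        exact mul_le_mul_of_nonneg_left (hf u) (hw u)
    _ = (∑ u, w u) * r := by rw [sum_mul]

/-- The same with the weight on the left. -/
theorem norm_sum_mul_le' {w : S → ℝ} (hw : ∀ u, 0 ≤ w u) {f : S → ℂ} {r : ℝ} (hf : ∀ u, ‖f u‖ ≤ r) :
    ‖∑ u, (w u : ℂ) * f u‖ ≤ (∑ u, w u) * r := by
  have := norm_sum_mul_le hw hf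
  rwa [show (∑ u, (w u : ℂ) * f u) = ∑ u, f u * (w u : ℂ) from sum_congr rfl fun u _ => mul_comm _ _]

/-- Convexity bookkeeping: `(x + α y)/(1 + α) ≤ max-type bound` — if `x ≤ k`, `y ≤ k`, `α ≥ 0` then `(x + α y)/(1+α) ≤ k`. -/
theorem div_convex_le {x y k α : ℝ} (hx : x ≤ k) (hy : y ≤ k) (hα : 0 ≤ α) : (x + α * y) / (1 + α) ≤ k := by
  rw [div_le_iff₀ (by linarith)]
  nlinarith

/-! ## §5c The envelope with scale-dependent weights -/

/-- **The envelope of the s-wave-dressed cascade with scale-dependent weights ((E2-v2) `PairLadderStepAt` at every step ⇒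
(B1-v2) `PairArrayAt`).**  Weights `w_n ≥ 0` per step (`W_n = Σ w_n`, no relation between different steps), a repulsive initial
s-wave value `U_0 ≥ 0` with its exact cascade `U_{n+1} = U_n / (1 + W_n U_n)`, arrays with the implicit ladder steps
`𝒞_{n+1} = 𝒞_n - 𝒞_{n+1} ∗_{w_n} 𝒞_n + T_n` (`n < N`), and the smallness `8·16·(esup 𝒟_0 + Σ_{j<N} esup T_j)·Σ_{j<N} W_j ≤ 1`
(`𝒟_n := 𝒞_n - U_n J`).  THEN for all `n ≤ N`: `0 ≤ U_n ≤ U_0` and `esup (𝒞_n - U_n J) ≤ 8·(esup (𝒞_0 - U_0 J) + Σ_{j<N} esup T_j)`. -/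
theorem sWaveCascade_envelope_varying {w : ℕ → S → ℝ} (hw : ∀ n u, 0 ≤ w n u) {𝒞 T : ℕ → S → S → ℂ} {U : ℕ → ℝ} {N : ℕ}
    (hU0 : 0 ≤ U 0) (hU : ∀ n, U (n + 1) = U n / (1 + (∑ u, w n u) * U n))
    (hstep : ∀ n < N, 𝒞 (n + 1) = 𝒞 n - wmul (w n) (𝒞 (n + 1)) (𝒞 n) + T n)
    (hsmall : 8 * 16 * (esup (𝒞 0 - ((U 0 : ℝ) : ℂ) • onesArr) + ∑ j ∈ range N, esup (T j)) *
      ∑ j ∈ range N, (∑ u, w j u) ≤ 1) :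
    ∀ n ≤ N, (0 ≤ U n ∧ U n ≤ U 0) ∧
      esup (𝒞 n - ((U n : ℝ) : ℂ) • onesArr) ≤ 8 * (esup (𝒞 0 - ((U 0 : ℝ) : ℂ) • onesArr) + ∑ j ∈ range N, esup (T j)) := by
  -- scalar cascade with `b n := 1`, `W` replaced by `W n` : reuse the fixed-`W` lemmas pointwise in `n` via `b n := W n`, `W := 1`
  set Wn : ℕ → ℝ := fun n => ∑ u, w n u with hWn
  have hWn0 : ∀ n, 0 ≤ Wn n := fun n => sum_nonneg fun u _ => hw n u
  have hU' : ∀ n, U (n + 1) = U n / (1 + Wn n * 1 * U n) := fun n => by rw [hU n, mul_one]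
  have hUn : ∀ n, 0 ≤ U n := sWave_nonneg (W := 1) zero_le_one hWn0 hU0 hU'
  have hUle : ∀ n, U n ≤ U 0 := sWave_le_init (W := 1) zero_le_one hWn0 hU0 hU'
  have hrel : ∀ n, U (n + 1) * (1 + Wn n * U n) = U n := fun n => by
    have := sWave_relation (W := 1) zero_le_one hWn0 hU0 hU' n; rwa [mul_one] at this
  have hα'1 : ∀ n, Wn n * U (n + 1) ≤ 1 := fun n => by
    have := sWave_alpha_succ_le_one (W := 1) zero_le_one hWn0 hU0 hU' n; rwa [mul_one] at this
  -- the arrays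
  set 𝒟 : ℕ → S → S → ℂ := fun n => 𝒞 n - ((U n : ℝ) : ℂ) • onesArr with h𝒟
  set E : ℕ → S → S → ℂ := fun n => T n - wmul (w n) (𝒟 (n + 1)) (𝒟 n) with hE
  set K : ℕ → S → S → ℂ := fun n => 𝒟 0 + ∑ j ∈ range n, E j with hK
  set k : ℕ → ℝ := fun n => esup (𝒟 0) + ∑ j ∈ range n, esup (E j) with hk
  have hK_succ : ∀ n, K (n + 1) = K n + E n := fun n => by simp only [hK, sum_range_succ]; abel
  have hk_succ : ∀ n, k (n + 1) = k n + esup (E n) := fun n => by simp only [hk, sum_range_succ]; ring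
  have hk_mono : ∀ n, k n ≤ k (n + 1) := fun n => by rw [hk_succ]; linarith [esup_nonneg (E n)]
  have hk0 : ∀ n, 0 ≤ k n := fun n => add_nonneg (esup_nonneg _) (sum_nonneg fun j _ => esup_nonneg _)
  have hKk : ∀ n, esup (K n) ≤ k n := by
    intro n
    induction n with
    | zero => simp [hK, hk]
    | succ n ih => rw [hK_succ, hk_succ]; exact (esup_add_le _ _).trans (add_le_add ih le_rfl)
  -- the implicit step identity at every `n < N`
  have hstar : ∀ n < N, 𝒟 (n + 1) + ((U n : ℝ) : ℂ) • wmul (w n) (𝒟 (n + 1)) onesArr =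
      𝒟 n - ((U (n + 1) : ℝ) : ℂ) • wmul (w n) onesArr (𝒟 n) + E n :=
    fun n hn => step_decompose' (w n) (hstep n hn) (hrel n) rfl rfl
  -- the row / column / scalar recursion
  set ρ : ℕ → S → ℂ := fun n t => ∑ u, (w n u : ℂ) * K n u t with hρ
  set κ : ℕ → S → ℂ := fun n s => ∑ u, K (n + 1) s u * (w n u : ℂ) with hκ
  set F : ℕ → (S → ℂ) × (S → ℂ) × ℂ → (S → ℂ) × (S → ℂ) × ℂ := fun n X =>
    ( fun t => (((1 - U (n + 1) * Wn n : ℝ)) : ℂ) * X.1 t - ((U (n + 1) : ℝ) : ℂ) * ρ n t,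
      fun s => (X.2.1 s - ((U n : ℝ) : ℂ) * κ n s) / (((1 + U n * Wn n : ℝ)) : ℂ),
      (X.2.2 * (((1 - U (n + 1) * Wn n : ℝ)) : ℂ) - ((U (n + 1) : ℝ) : ℂ) * (∑ u, (w n u : ℂ) * X.2.1 u) -
        ((U n : ℝ) : ℂ) * (∑ u, ((((1 - U (n + 1) * Wn n : ℝ)) : ℂ) * X.1 u - ((U (n + 1) : ℝ) : ℂ) * ρ n u) * (w n u : ℂ))) /
        (((1 + U n * Wn n : ℝ)) : ℂ) ) with hF
  obtain ⟨X, hX0, hXs⟩ : ∃ X : ℕ → (S → ℂ) × (S → ℂ) × ℂ, X 0 = (0, 0, 0) ∧ ∀ n, X (n + 1) = F n (X n) :=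
    ⟨fun n => Nat.rec ((0 : S → ℂ), (0 : S → ℂ), (0 : ℂ)) F n, rfl, fun n => rfl⟩
  -- the recursion equations, componentwise
  have hden : ∀ n, (((1 + U n * Wn n : ℝ)) : ℂ) ≠ 0 := fun n => by
    have : (0 : ℝ) < 1 + U n * Wn n := by have := mul_nonneg (hUn n) (hWn0 n); linarith
    exact_mod_cast this.ne'
  have eR : ∀ n t, (X (n + 1)).1 t =
      (((1 - U (n + 1) * Wn n : ℝ)) : ℂ) * (X n).1 t - ((U (n + 1) : ℝ) : ℂ) * ρ n t := fun n t => by rw [hXs n]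
  have eC : ∀ n s, (X (n + 1)).2.1 s * (((1 + U n * Wn n : ℝ)) : ℂ) = (X n).2.1 s - ((U n : ℝ) : ℂ) * κ n s :=
    fun n s => by rw [hXs n]; exact div_mul_cancel₀ _ (hden n)
  have eσ : ∀ n, (X (n + 1)).2.2 * (((1 + U n * Wn n : ℝ)) : ℂ) =
      (X n).2.2 * (((1 - U (n + 1) * Wn n : ℝ)) : ℂ) - ((U (n + 1) : ℝ) : ℂ) * (∑ u, (w n u : ℂ) * (X n).2.1 u) -
        ((U n : ℝ) : ℂ) * (∑ u, (X (n + 1)).1 u * (w n u : ℂ)) := fun n => by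
    have h1 : (X (n + 1)).2.2 = (F n (X n)).2.2 := by rw [hXs n]
    have h2 : ∀ u, (X (n + 1)).1 u = (F n (X n)).1 u := fun u => by rw [hXs n]
    rw [h1]
    simp only [hF]
    rw [div_mul_cancel₀ _ (hden n)]
    congr 1
    congr 1
    exact sum_congr rfl fun u _ => by rw [h2 u]
  -- MAIN INDUCTION: decomposition + bounds
  have main : ∀ n ≤ N, 𝒟 n = K n + (fun _ t => (X n).1 t) + (fun s _ => (X n).2.1 s) + (X n).2.2 • onesArr ∧
      (∀ t, ‖(X n).1 t‖ ≤ k n) ∧ (∀ s, ‖(X n).2.1 s‖ ≤ k n) ∧ ‖(X n).2.2‖ ≤ k n := by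
    intro n
    induction n with
    | zero =>
      intro _
      refine ⟨?_, fun t => ?_, fun s => ?_, ?_⟩
      · funext s t; simp [hK, hX0]
      · simp [hX0, hk0 0]
      · simp [hX0, hk0 0]
      · simp [hX0, hk0 0]
    | succ n ih =>
      intro hn
      have hn' : n < N := Nat.lt_of_succ_le hn
      obtain ⟨hdec, hR, hC, hσ⟩ := ih hn'.le
      have hWUn : 0 ≤ U n * Wn n := mul_nonneg (hUn n) (hWn0 n)
      have hα'0 : 0 ≤ U (n + 1) * Wn n := mul_nonneg (hUn (n + 1)) (hWn0 n)
      have hα'1' : U (n + 1) * Wn n ≤ 1 := by rw [mul_comm]; exact hα'1 n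
      -- (1) the decomposition at n+1: candidate and uniqueness
      set Xc : S → S → ℂ := K (n + 1) + (fun _ t => (X (n + 1)).1 t) + (fun s _ => (X (n + 1)).2.1 s) +
        (X (n + 1)).2.2 • onesArr with hXc
      have hcand : Xc + ((U n : ℝ) : ℂ) • wmul (w n) Xc onesArr =
          𝒟 n - ((U (n + 1) : ℝ) : ℂ) • wmul (w n) onesArr (𝒟 n) + E n := by
        rw [hdec]
        funext s t
        simp only [hXc, Pi.add_apply, Pi.sub_apply, Pi.smul_apply, smul_eq_mul, wmul_decomp_onesArr, onesArr_wmul_decomp,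
          onesArr, mul_one, hK_succ]
        have e1 := eR n t
        have e2 := eC n s
        have e3 := eσ n
        have eκ : κ n s = ∑ u, K (n + 1) s u * (w n u : ℂ) := rfl
        have eρ : ρ n t = ∑ u, (w n u : ℂ) * K n u t := rfl
        rw [hK_succ] at eκ
        simp only [Pi.add_apply] at eκ
        have eW : (∑ u, (w n u : ℂ)) = ((Wn n : ℝ) : ℂ) := by rw [hWn]; push_cast; rfl
        rw [eW]
        rw [eκ] at e2
        rw [eρ] at e1
        push_cast at e1 e2 e3 ⊢
        linear_combination e1 + e2 + e3
      have hdiff : (𝒟 (n + 1) - Xc) + ((U n : ℝ) : ℂ) • wmul (w n) (𝒟 (n + 1) - Xc) onesArr = 0 := by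
        rw [wmul_sub_left, smul_sub]
        have := hstar n hn'
        rw [← sub_eq_zero] 
        have h2 := hcand
        calc 𝒟 (n + 1) - Xc + (((U n : ℝ) : ℂ) • wmul (w n) (𝒟 (n + 1)) onesArr - ((U n : ℝ) : ℂ) • wmul (w n) Xc onesArr) - 0
            = (𝒟 (n + 1) + ((U n : ℝ) : ℂ) • wmul (w n) (𝒟 (n + 1)) onesArr) -
                (Xc + ((U n : ℝ) : ℂ) • wmul (w n) Xc onesArr) := by abel
          _ = 0 := by rw [this, h2, sub_self]
      have hdec' : 𝒟 (n + 1) = Xc := by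
        have := eq_zero_of_add_smul_wmul_onesArr (hw n) (hUn n) hdiff
        exact sub_eq_zero.1 this
      -- (2) the bounds
      have hρb : ∀ t, ‖ρ n t‖ ≤ Wn n * k n := fun t =>
        (norm_sum_mul_le' (hw n) (fun u => le_esup (K n) u t)).trans (mul_le_mul_of_nonneg_left (hKk n) (hWn0 n))
      have hκb : ∀ s, ‖κ n s‖ ≤ Wn n * k (n + 1) := fun s =>
        (norm_sum_mul_le (hw n) (fun u => le_esup (K (n + 1)) s u)).trans (mul_le_mul_of_nonneg_left (hKk (n + 1)) (hWn0 n))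
      have hkn := hk_mono n
      have hR' : ∀ t, ‖(X (n + 1)).1 t‖ ≤ k (n + 1) := by
        intro t
        rw [eR n t]
        refine (norm_sub_le _ _).trans ?_
        rw [norm_mul, norm_mul, Complex.norm_real, Complex.norm_real, Real.norm_eq_abs, Real.norm_eq_abs,
          abs_of_nonneg (by linarith), abs_of_nonneg (hUn (n + 1))]
        have h1 : (1 - U (n + 1) * Wn n) * ‖(X n).1 t‖ ≤ (1 - U (n + 1) * Wn n) * k n :=
          mul_le_mul_of_nonneg_left (hR t) (by linarith)
        have h2 : U (n + 1) * ‖ρ n t‖ ≤ U (n + 1) * (Wn n * k n) := mul_le_mul_of_nonneg_left (hρb t) (hUn (n + 1))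
        nlinarith
      have hC' : ∀ s, ‖(X (n + 1)).2.1 s‖ ≤ k (n + 1) := by
        intro s
        have e2 := eC n s
        have hnorm : ‖(X (n + 1)).2.1 s‖ * (1 + U n * Wn n) = ‖(X n).2.1 s - ((U n : ℝ) : ℂ) * κ n s‖ := by
          rw [← e2, norm_mul, Complex.norm_real, Real.norm_eq_abs, abs_of_nonneg (by linarith)]
        have hb : ‖(X n).2.1 s - ((U n : ℝ) : ℂ) * κ n s‖ ≤ k (n + 1) + U n * Wn n * k (n + 1) := by
          refine (norm_sub_le _ _).trans ?_
          rw [norm_mul, Complex.norm_real, Real.norm_eq_abs, abs_of_nonneg (hUn n)]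
          have := mul_le_mul_of_nonneg_left (hκb s) (hUn n)
          linarith [hC s]
        have hpos : 0 < 1 + U n * Wn n := by linarith
        have h' : ‖(X (n + 1)).2.1 s‖ * (1 + U n * Wn n) ≤ k (n + 1) * (1 + U n * Wn n) := by rw [hnorm]; linarith
        exact le_of_mul_le_mul_right h' hpos
      have hσ' : ‖(X (n + 1)).2.2‖ ≤ k (n + 1) := by
        have e3 := eσ n
        have hnorm : ‖(X (n + 1)).2.2‖ * (1 + U n * Wn n) =
            ‖(X n).2.2 * (((1 - U (n + 1) * Wn n : ℝ)) : ℂ) - ((U (n + 1) : ℝ) : ℂ) * (∑ u, (w n u : ℂ) * (X n).2.1 u) -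
              ((U n : ℝ) : ℂ) * (∑ u, (X (n + 1)).1 u * (w n u : ℂ))‖ := by
          rw [← e3, norm_mul, Complex.norm_real, Real.norm_eq_abs, abs_of_nonneg (by linarith)]
        have hC_avg : ‖∑ u, (w n u : ℂ) * (X n).2.1 u‖ ≤ Wn n * k n := norm_sum_mul_le' (hw n) hC
        have hR_avg : ‖∑ u, (X (n + 1)).1 u * (w n u : ℂ)‖ ≤ Wn n * k (n + 1) := norm_sum_mul_le (hw n) hR'
        have hb : ‖(X n).2.2 * (((1 - U (n + 1) * Wn n : ℝ)) : ℂ) - ((U (n + 1) : ℝ) : ℂ) * (∑ u, (w n u : ℂ) * (X n).2.1 u) -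
              ((U n : ℝ) : ℂ) * (∑ u, (X (n + 1)).1 u * (w n u : ℂ))‖ ≤ k (n + 1) + U n * Wn n * k (n + 1) := by
          refine (norm_sub_le _ _).trans ?_
          refine (add_le_add (norm_sub_le _ _) le_rfl).trans ?_
          rw [norm_mul, norm_mul, norm_mul, Complex.norm_real, Complex.norm_real, Complex.norm_real, Real.norm_eq_abs,
            Real.norm_eq_abs, Real.norm_eq_abs, abs_of_nonneg (by linarith : (0:ℝ) ≤ 1 - U (n + 1) * Wn n),
            abs_of_nonneg (hUn (n + 1)), abs_of_nonneg (hUn n)]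
          have h1 : ‖(X n).2.2‖ * (1 - U (n + 1) * Wn n) ≤ k n * (1 - U (n + 1) * Wn n) :=
            mul_le_mul_of_nonneg_right hσ (by linarith)
          have h2 : U (n + 1) * ‖∑ u, (w n u : ℂ) * (X n).2.1 u‖ ≤ U (n + 1) * (Wn n * k n) :=
            mul_le_mul_of_nonneg_left hC_avg (hUn (n + 1))
          have h3 : U n * ‖∑ u, (X (n + 1)).1 u * (w n u : ℂ)‖ ≤ U n * (Wn n * k (n + 1)) :=
            mul_le_mul_of_nonneg_left hR_avg (hUn n)
          nlinarith
        have hpos : 0 < 1 + U n * Wn n := by linarith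
        have h' : ‖(X (n + 1)).2.2‖ * (1 + U n * Wn n) ≤ k (n + 1) * (1 + U n * Wn n) := by rw [hnorm]; linarith
        exact le_of_mul_le_mul_right h' hpos
      exact ⟨by rw [hdec'], hR', hC', hσ'⟩
  -- `esup 𝒟 n ≤ 4 k n`
  have he : ∀ n ≤ N, esup (𝒟 n) ≤ 4 * k n := by
    intro n hn
    obtain ⟨hdec, hR, hC, hσ⟩ := main n hn
    refine esup_le (fun s t => ?_) (by linarith [hk0 n])
    rw [hdec]
    simp only [Pi.add_apply, Pi.smul_apply, smul_eq_mul, onesArr, mul_one]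
    have h1 := le_esup (K n) s t
    calc ‖K n s t + (X n).1 t + (X n).2.1 s + (X n).2.2‖
        ≤ ‖K n s t‖ + ‖(X n).1 t‖ + ‖(X n).2.1 s‖ + ‖(X n).2.2‖ := by
          refine (norm_add_le _ _).trans (add_le_add ((norm_add_le _ _).trans (add_le_add (norm_add_le _ _) le_rfl)) le_rfl)
      _ ≤ 4 * k n := by linarith [hKk n, hR t, hC s]
  -- Gronwall on `k`
  have hkstep : ∀ n < N, k (n + 1) * (1 - 16 * Wn n * k n) ≤ k n + esup (T n) := by
    intro n hn
    have h1 : esup (E n) ≤ esup (T n) + esup (𝒟 (n + 1)) * Wn n * esup (𝒟 n) := by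
      have := esup_sub_le (T n) (wmul (w n) (𝒟 (n + 1)) (𝒟 n))
      have h2 := esup_wmul_le (w n) (hw n) (𝒟 (n + 1)) (𝒟 n)
      simp only [hE]; linarith
    have h2 : esup (𝒟 (n + 1)) * Wn n * esup (𝒟 n) ≤ (4 * k (n + 1)) * Wn n * (4 * k n) :=
      mul_le_mul (mul_le_mul_of_nonneg_right (he (n + 1) (Nat.succ_le_of_lt hn)) (hWn0 n)) (he n hn.le) (esup_nonneg _)
        (mul_nonneg (by linarith [hk0 (n + 1)]) (hWn0 n))
    have h3 : esup (E n) ≤ esup (T n) + 16 * Wn n * k (n + 1) * k n := by linarith [h1, h2]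
    calc k (n + 1) * (1 - 16 * Wn n * k n) = k (n + 1) - 16 * Wn n * k (n + 1) * k n := by ring
      _ = k n + esup (E n) - 16 * Wn n * k (n + 1) * k n := by rw [hk_succ n]
      _ ≤ k n + esup (T n) := by linarith [h3]
  have hsmall' : 8 * 16 * (k 0 + ∑ j ∈ range N, esup (T j)) * ∑ j ∈ range N, Wn j ≤ 1 := by
    have : k 0 = esup (𝒟 0) := by simp [hk]
    rw [this]; exact hsmall
  have hG := implicit_gronwall (d := k) (t := fun n => esup (T n)) (b := Wn) (K := 16) (by norm_num) hk0
    (fun n => esup_nonneg _) hWn0 (fun n hn => by simpa [mul_assoc, mul_comm, mul_left_comm] using hkstep n hn) hsmall'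
  intro n hn
  refine ⟨⟨hUn n, hUle n⟩, ?_⟩
  have hk0' : k 0 = esup (𝒟 0) := by simp [hk]
  calc esup (𝒟 n) ≤ 4 * k n := he n hn
    _ ≤ 4 * (2 * (k 0 + ∑ j ∈ range N, esup (T j))) := by linarith [hG n hn]
    _ = 8 * (esup (𝒟 0) + ∑ j ∈ range N, esup (T j)) := by rw [hk0']; ring

end Summit.HubbardSuperconductivity.HubbardSuperconductivity.Theorems.SWaveCascade

end
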